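import Summits.BirchSwinnertonDyer.Rank1Residual.X11b.Three.GoodReductionSubgroupGaloisH1
import HarnessLib

/-!
# X11b at `p = 3` (team N8/O2), JET3-KUMMER (α): inflation — `H¹` of `E₀` over a layer `L`
# from `H¹` over a bigger layer `L' ⊇ L` (the non-split node with `[k : k_v]` odd)

HONEST FRAMING (cell `b2b-bsdres`, run/shared/lean/b2b/bsd-rank1-residual/, verbatim in every
file): the goal of the cell is to DELETE the COMBINATION-SHAPED residual classes of the
Birch–Swinnerton-Dyer formula for ALL analytic-rank `≤ 1` elliptic curves over `ℚ` — "full BSD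
formula for every rank `≤ 1` curve in class `C`" assembled STRICTLY from published theorems — so
that the rank-`≤ 1` remainder becomes exactly the CONSTRUCTION-SHAPED classes, which are TYPED
(missing-input `Prop`s), NOT attempted. This is not "finishing BSD". Team N8/O2 = `x11b3`, seat
`b2b-bsdres-x11b3-p4`, LEAD DEAL #6 A6.2, S15 (ii) (the non-split node that stays non-split over
the residue field `k` of `L`, i.e. `[k : k_v]` odd), part 9. THEOREMS ONLY: no definition, no named
fact, no `sorry`; nothing is booked; `JET@p|N` NOT discharged.

## What

`GoodReductionSubgroupNodeH1` / `GoodReductionSubgroupFormalH1` prove (α) — in cyclic form,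
`H¹(⟨φ⟩, E₀(L)) = 0` — at a place whose node is PRESENTED over `k` (tangent slopes in `k`). When
`E` has non-split multiplicative reduction at `v` and `[k : k_v]` is odd the slopes are not in `k`;
they are in the residue field `k'` of the unramified quadratic extension `L' ⊇ L` (`[k' : k_v]`
even). This file proves the **inflation step** that reduces the odd case to the even one, in p1's
dictionary (`X / F`, tower `F ⊆ L ⊆ L'` with discrete valuation rings `R → R'` LOCAL, minimal
equations, `φ' ∈ Aut(L'/F)` restricting to `φ ∈ Aut(L/F)`):

* §1 (d) along `L → L'`: `integralModel_map_eq`, `reduction_map_eq`,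
  `isNonsingularReductionPoint_map_iff`, **`map_mem_goodReductionSubgroup_iff`** (`E₀(L') ∩ E(L) =
  E₀(L)` for the map of points along `L →ₐ[F] L'`; same proof as part 1).
* §2 `map_smul_eq`, `map_pow_smul_eq` (`ι_*` intertwines `φ` and `φ'`),
  `exists_map_eq_of_smul_pow_eq` (a point of `E(L')` fixed by `φ'ⁿ` comes from `E(L)`, granted
  `Fix(φ'ⁿ) = L` — hypothesis `hdesc`, i.e. `Gal(L'/L) = ⟨φ'ⁿ⟩`).
* §3 **`cyclicH1_of_inflation`**: if `H¹(⟨φ'⟩, E₀(L')) = 0` in cyclic form for some `N'` with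
  `n ∣ N'` (`φ'^{N'} = 1`), then `H¹(⟨φ⟩, E₀(L)) = 0` in cyclic form: for `m ∈ E₀(L)` with
  `Σ_{j<n} φʲ m = O`, the norm of `ι m` over `N'` vanishes, so `ι m = φ' P' − P'` with
  `P' ∈ E₀(L')`; then `φ'ⁿ P' − P' = Σ_{j<n} φ'ʲ(ι m) = ι(Σ φʲ m) = O`, so `P'` is `φ'ⁿ`-fixed, hence
  `P' = ι P` with `P ∈ E₀(L)` and `φ P − P = m` (injectivity of `ι`). This is the
  inflation–restriction injectivity `H¹(L/F, E₀(L)) ↪ H¹(L'/F, E₀(L'))` made explicit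
  (Serre, *Local Fields* VII §6; with `E₀(L')^{Gal(L'/L)} = E₀(L)` = §1).
  **`hα_of_inflation`** — p1's hypothesis (α) for `L` from the cyclic vanishing over `L'`.

With `GoodReductionSubgroupFormalH1` at `L'` (node presented over `k'`) this covers the remaining
sub-case of (α) at multiplicative places, modulo the existence of the unramified quadratic layer
`L'` with its standard properties (instantiation, not done here).

References (locators only; no new fact): [cite: SerreLocalFields1979, VII §6 (inflation–restriction)]
[cite: MilneADT2006, Ch. I Prop. 3.8] [cite: SilvermanAEC2009, VII.2 Prop. 2.1].

## Design

No definitions; `noncomputable section`; `open scoped Classical`; universe `u` for `F, L, L'`.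
Axioms: `propext`, `Classical.choice`, `Quot.sound`.
-/

noncomputable section

open scoped Classical

namespace Summit.BirchSwinnertonDyer.Rank1Residual.X11b.Three.JetchevKummer

open WeierstrassCurve

universe u

variable {F : Type u} [Field F] (X : WeierstrassCurve F) (L : Type u) [Field L] [Algebra F L]
  (L' : Type u) [Field L'] [Algebra F L'] [Algebra L L'] [IsScalarTower F L L']
  (R : Type*) [CommRing R] [IsDomain R] [IsDiscreteValuationRing R] [Algebra R L]
  [IsFractionRing R L]
  (R' : Type*) [CommRing R'] [IsDomain R'] [IsDiscreteValuationRing R'] [Algebra R' L']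
  [IsFractionRing R' L']
  [Algebra R R'] [Algebra R L'] [IsScalarTower R R' L'] [IsScalarTower R L L']

/-! ### §1 (d) along the layer extension `L → L'` -/

omit [IsDomain R] [IsDiscreteValuationRing R] [IsFractionRing R L] [IsDomain R']
  [IsDiscreteValuationRing R'] in
/-- Integral models along `L → L'`: the `R'`-model of `X ⊗ L'` is the `R`-model of `X ⊗ L` mapped
along `R → R'`. [folklore] -/
theorem integralModel_map_eq [(X.baseChange L).IsIntegral R] [(X.baseChange L').IsIntegral R'] :
    (X.baseChange L').integralModel R' = ((X.baseChange L).integralModel R).map (algebraMap R R') := by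
  apply WeierstrassCurve.map_injective (IsFractionRing.injective R' L')
  change ((X.baseChange L').integralModel R').map (algebraMap R' L') =
    (((X.baseChange L).integralModel R).map (algebraMap R R')).map (algebraMap R' L')
  have h1 : ((X.baseChange L').integralModel R').map (algebraMap R' L') = X.baseChange L' :=
    baseChange_integralModel_eq R' (X.baseChange L')
  have h2 : ((X.baseChange L).integralModel R).map (algebraMap R L) = X.baseChange L :=
    baseChange_integralModel_eq R (X.baseChange L)
  rw [h1, WeierstrassCurve.map_map, ← IsScalarTower.algebraMap_eq R R' L',
    IsScalarTower.algebraMap_eq R L L', ← WeierstrassCurve.map_map, h2, WeierstrassCurve.baseChange,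
    WeierstrassCurve.baseChange, WeierstrassCurve.map_map, ← IsScalarTower.algebraMap_eq F L L']

/-- Reductions along `L → L'`. [folklore] -/
theorem reduction_map_eq [IsLocalHom (algebraMap R R')]
    [(X.baseChange L).IsMinimal R] [(X.baseChange L').IsMinimal R'] :
    (X.baseChange L').reduction R' =
      ((X.baseChange L).reduction R).map (IsLocalRing.ResidueField.map (algebraMap R R')) := by
  have hc : (IsLocalRing.residue R').comp (algebraMap R R') =
      (IsLocalRing.ResidueField.map (algebraMap R R')).comp (IsLocalRing.residue R) :=
    RingHom.ext fun r ↦ (IsLocalRing.ResidueField.map_residue (algebraMap R R') r).symm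
  rw [WeierstrassCurve.reduction, WeierstrassCurve.reduction, integralModel_map_eq X L L' R R',
    WeierstrassCurve.map_map, WeierstrassCurve.map_map, hc]

/-- **(d) along `L → L'`**: a point of `E(L)` has nonsingular reduction over `L'` iff over `L`
(`ι_* = Affine.Point.map (L →ₐ[F] L')`). Silverman, *AEC* VII.2. [folklore] -/
theorem map_mem_goodReductionSubgroup_iff [IsLocalHom (algebraMap R R')]
    [(X.baseChange L).IsMinimal R] [(X.baseChange L').IsMinimal R']
    (P : (X.baseChange L).toAffine.Point) :
    Affine.Point.map (W' := X) (IsScalarTower.toAlgHom F L L') P ∈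
        (X.baseChange L').goodReductionSubgroup R' ↔
      P ∈ (X.baseChange L).goodReductionSubgroup R := by
  rw [WeierstrassCurve.mem_goodReductionSubgroup_iff_holds R' (X.baseChange L') _,
    WeierstrassCurve.mem_goodReductionSubgroup_iff_holds R (X.baseChange L) P]
  rcases P with _ | ⟨x, y, h⟩
  · rw [show (Affine.Point.zero : (X.baseChange L).toAffine.Point) = 0 from rfl, map_zero]
    exact Iff.rfl
  · rw [Affine.Point.map_some]
    change ((algebraMap L L' x ∉ Set.range (algebraMap R' L')) ∨
        ∃ x₀ y₀ : R', algebraMap R' L' x₀ = algebraMap L L' x ∧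
          algebraMap R' L' y₀ = algebraMap L L' y ∧
          ((X.baseChange L').reduction R').toAffine.Nonsingular (IsLocalRing.residue R' x₀)
            (IsLocalRing.residue R' y₀)) ↔
      ((x ∉ Set.range (algebraMap R L)) ∨
        ∃ x₀ y₀ : R, algebraMap R L x₀ = x ∧ algebraMap R L y₀ = y ∧
          ((X.baseChange L).reduction R).toAffine.Nonsingular (IsLocalRing.residue R x₀)
            (IsLocalRing.residue R y₀))
    have hιR : ∀ a : R, algebraMap R' L' (algebraMap R R' a) = algebraMap L L' (algebraMap R L a) :=
      fun a ↦ by rw [← IsScalarTower.algebraMap_apply, IsScalarTower.algebraMap_apply R L L']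
    refine or_congr (not_congr (algebraMap_mem_range_iff L' R R' x)) ⟨?_, ?_⟩
    · rintro ⟨x₀, y₀, hx₀, hy₀, hns⟩
      obtain ⟨a, rfl⟩ := (algebraMap_mem_range_iff L' R R' x).mp ⟨x₀, hx₀⟩
      obtain ⟨b, rfl⟩ := (algebraMap_mem_range_iff L' R R' y).mp ⟨y₀, hy₀⟩
      have ha : x₀ = algebraMap R R' a := IsFractionRing.injective R' L' (by rw [hx₀, hιR])
      have hb : y₀ = algebraMap R R' b := IsFractionRing.injective R' L' (by rw [hy₀, hιR])
      refine ⟨a, b, rfl, rfl, ?_⟩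
      rw [reduction_map_eq X L L' R R', ha, hb, ← IsLocalRing.ResidueField.map_residue,
        ← IsLocalRing.ResidueField.map_residue] at hns
      exact (Affine.map_nonsingular _
        (IsLocalRing.ResidueField.map (algebraMap R R')).injective _ _).mp hns
    · rintro ⟨a, b, rfl, rfl, hns⟩
      refine ⟨algebraMap R R' a, algebraMap R R' b, hιR a, hιR b, ?_⟩
      rw [reduction_map_eq X L L' R R', ← IsLocalRing.ResidueField.map_residue,
        ← IsLocalRing.ResidueField.map_residue]
      exact (Affine.map_nonsingular _
        (IsLocalRing.ResidueField.map (algebraMap R R')).injective _ _).mpr hns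

/-! ### §2 `ι_*` intertwines the Frobenius elements; descent of `φ'ⁿ`-fixed points -/

omit [IsScalarTower F L L'] in
/-- `ι_* (φ • P) = φ' • ι_* P` when `φ'` restricts to `φ`. [folklore] -/
theorem map_smul_eq (φ : L ≃ₐ[F] L) (φ' : L' ≃ₐ[F] L') [IsScalarTower F L L']
    (hcompat : ∀ x : L, φ' (algebraMap L L' x) = algebraMap L L' (φ x))
    (P : (X.baseChange L).toAffine.Point) :
    Affine.Point.map (W' := X) (IsScalarTower.toAlgHom F L L') (φ • P) =
      φ' • Affine.Point.map (W' := X) (IsScalarTower.toAlgHom F L L') P := by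
  have hc : (φ' : L' →ₐ[F] L').comp (IsScalarTower.toAlgHom F L L') =
      (IsScalarTower.toAlgHom F L L').comp (φ : L →ₐ[F] L) :=
    AlgHom.ext fun x ↦ by simpa using hcompat x
  rw [WeierstrassCurve.smul_def, WeierstrassCurve.smul_def, Affine.Point.map_map,
    Affine.Point.map_map, hc]

omit [IsScalarTower F L L'] in
/-- `ι_* (φʲ • P) = φ'ʲ • ι_* P`. [folklore] -/
theorem map_pow_smul_eq (φ : L ≃ₐ[F] L) (φ' : L' ≃ₐ[F] L') [IsScalarTower F L L']
    (hcompat : ∀ x : L, φ' (algebraMap L L' x) = algebraMap L L' (φ x)) (j : ℕ)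
    (P : (X.baseChange L).toAffine.Point) :
    Affine.Point.map (W' := X) (IsScalarTower.toAlgHom F L L') (φ ^ j • P) =
      φ' ^ j • Affine.Point.map (W' := X) (IsScalarTower.toAlgHom F L L') P := by
  induction j generalizing P with
  | zero => simp
  | succ j ih => rw [pow_succ, pow_succ, mul_smul, mul_smul, ih, map_smul_eq X L L' φ φ' hcompat]

/-- **Descent of `φ'ⁿ`-fixed points**: if the fixed field of `φ'ⁿ` is `L` (`hdesc`), a point of
`E(L')` fixed by `φ'ⁿ` is `ι_* P` for a point `P ∈ E(L)`. Silverman, *AEC* VIII.§1. [folklore] -/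
theorem exists_map_eq_of_pow_smul_eq (φ' : L' ≃ₐ[F] L') {n : ℕ}
    (hdesc : ∀ x : L', (φ' ^ n) x = x → x ∈ Set.range (algebraMap L L'))
    {Q : (X.baseChange L').toAffine.Point} (hQ : (φ' ^ n) • Q = Q) :
    ∃ P : (X.baseChange L).toAffine.Point,
      Affine.Point.map (W' := X) (IsScalarTower.toAlgHom F L L') P = Q := by
  rcases Q with _ | ⟨x, y, h⟩
  · exact ⟨0, rfl⟩
  · rw [WeierstrassCurve.smul_def, Affine.Point.map_some] at hQ
    simp only [Affine.Point.some.injEq, AlgEquiv.coe_toAlgHom] at hQ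
    obtain ⟨x₀, rfl⟩ := hdesc x hQ.1
    obtain ⟨y₀, rfl⟩ := hdesc y hQ.2
    have h₀ : (X.baseChange L).toAffine.Nonsingular x₀ y₀ :=
      (Affine.baseChange_nonsingular X (IsScalarTower.toAlgHom F L L').injective x₀ y₀).mp h
    exact ⟨.some x₀ y₀ h₀, by rw [Affine.Point.map_some]; rfl⟩

/-! ### §3 Inflation: cyclic `H¹` over `L` from cyclic `H¹` over `L'` -/

/-- **Inflation** (`H¹(L/F, E₀(L)) ↪ H¹(L'/F, E₀(L'))`, made explicit in cyclic form). Tower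
`F ⊆ L ⊆ L'` with discrete valuation rings `R → R'` local and minimal equations; `φ' ∈ Aut(L'/F)`
restricting to `φ ∈ Aut(L/F)` (`hcompat`); the fixed field of `φ'ⁿ` is `L` (`hdesc`); `n ∣ N'`.
If every `m' ∈ E₀(L')` with `Σ_{j<N'} φ'ʲ m' = O` is `φ' P' − P'` with `P' ∈ E₀(L')`, then every
`m ∈ E₀(L)` with `Σ_{j<n} φʲ m = O` is `φ P − P` with `P ∈ E₀(L)`: the lifted `P'` satisfies
`φ'ⁿ P' − P' = Σ_{j<n} φ'ʲ (ι m) = O`, so it descends, and `E₀(L') ∩ E(L) = E₀(L)` (§1).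
Serre, *Local Fields* VII §6. [cite: SerreLocalFields1979, VII §6 (inflation–restriction)] -/
theorem cyclicH1_of_inflation [IsLocalHom (algebraMap R R')]
    [(X.baseChange L).IsMinimal R] [(X.baseChange L').IsMinimal R']
    (φ : L ≃ₐ[F] L) (φ' : L' ≃ₐ[F] L')
    (hcompat : ∀ x : L, φ' (algebraMap L L' x) = algebraMap L L' (φ x))
    {n N' : ℕ} (hnN : n ∣ N')
    (hdesc : ∀ x : L', (φ' ^ n) x = x → x ∈ Set.range (algebraMap L L'))
    (h1' : ∀ m' ∈ (X.baseChange L').goodReductionSubgroup R',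
      ∑ j ∈ Finset.range N', (φ' ^ j) • m' = 0 →
        ∃ P' ∈ (X.baseChange L').goodReductionSubgroup R', φ' • P' - P' = m') :
    ∀ m ∈ (X.baseChange L).goodReductionSubgroup R, ∑ j ∈ Finset.range n, (φ ^ j) • m = 0 →
      ∃ P ∈ (X.baseChange L).goodReductionSubgroup R, φ • P - P = m := by
  intro m hm hs
  set ι := Affine.Point.map (W' := X) (IsScalarTower.toAlgHom F L L') with hι
  have hιm : ι m ∈ (X.baseChange L').goodReductionSubgroup R' :=
    (map_mem_goodReductionSubgroup_iff X L L' R R' m).mpr hm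
  -- the norm over `n` of `ι m` vanishes, hence over `N' = n e`
  have hn0 : ∑ j ∈ Finset.range n, (φ' ^ j) • ι m = 0 := by
    have : ∑ j ∈ Finset.range n, (φ' ^ j) • ι m = ι (∑ j ∈ Finset.range n, (φ ^ j) • m) := by
      rw [map_sum]
      exact Finset.sum_congr rfl fun j _ ↦ (map_pow_smul_eq X L L' φ φ' hcompat j m).symm
    rw [this, hs, map_zero]
  have hmul : ∀ e : ℕ, ∑ j ∈ Finset.range (n * e), (φ' ^ j) • ι m = 0 := by
    intro e
    induction e with
    | zero => simp
    | succ e ih =>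
      rw [Nat.mul_succ, Finset.sum_range_add, ih, zero_add]
      have : ∀ j, (φ' ^ (n * e + j)) • ι m = (φ' ^ (n * e)) • ((φ' ^ j) • ι m) := fun j ↦ by
        rw [pow_add, mul_smul]
      simp_rw [this]
      rw [← Finset.smul_sum, hn0, smul_zero]
  obtain ⟨e, rfl⟩ := hnN
  obtain ⟨P', hP'E, hP'⟩ := h1' (ι m) hιm (hmul e)
  -- `P'` is fixed by `φ'ⁿ`
  have hfix : (φ' ^ n) • P' = P' := by
    have := sum_range_pow_smul_smul_sub φ' P' n
    rw [hP', hn0] at this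
    exact (sub_eq_zero.mp this.symm)
  obtain ⟨P, rfl⟩ := exists_map_eq_of_pow_smul_eq X L L' φ' hdesc hfix
  refine ⟨P, (map_mem_goodReductionSubgroup_iff X L L' R R' P).mp hP'E, ?_⟩
  apply Affine.Point.map_injective (IsScalarTower.toAlgHom F L L')
  rw [map_sub, map_smul_eq X L L' φ φ' hcompat]
  exact hP'

/-- **(α) for the layer `L` by inflation from `L'`** (p1's hypothesis `hα` of `JetchevKummerAtP`):
with `Gal(L/F) = ⟨φ⟩`, `φⁿ = 1`, and the hypotheses of `cyclicH1_of_inflation`, every `Q ∈ E(L)`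
with all `σ Q − Q ∈ E₀(L)` is congruent modulo `E₀(L)` to a fixed point. Combined with
`GoodReductionSubgroupFormalH1` / `GoodReductionSubgroupNodeH1` for the quadratic unramified layer
`L'` (node presented over its residue field), this is (α) at a NON-SPLIT node with `[k : k_v]` odd.
[cite: SerreLocalFields1979, VII §6] [cite: MilneADT2006, Ch. I Prop. 3.8] -/
theorem hα_of_inflation [IsLocalHom (algebraMap R R')]
    [(X.baseChange L).IsMinimal R] [(X.baseChange L').IsMinimal R']
    (φ : L ≃ₐ[F] L) (hφ : ∀ σ : L ≃ₐ[F] L, σ ∈ Subgroup.zpowers φ) {n : ℕ} (hn : φ ^ n = 1)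
    (φ' : L' ≃ₐ[F] L') (hcompat : ∀ x : L, φ' (algebraMap L L' x) = algebraMap L L' (φ x))
    {N' : ℕ} (hnN : n ∣ N')
    (hdesc : ∀ x : L', (φ' ^ n) x = x → x ∈ Set.range (algebraMap L L'))
    (h1' : ∀ m' ∈ (X.baseChange L').goodReductionSubgroup R',
      ∑ j ∈ Finset.range N', (φ' ^ j) • m' = 0 →
        ∃ P' ∈ (X.baseChange L').goodReductionSubgroup R', φ' • P' - P' = m') :
    ∀ Q : (X.baseChange L).toAffine.Point,
      (∀ σ : L ≃ₐ[F] L, σ • Q - Q ∈ (X.baseChange L).goodReductionSubgroup R) →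
        ∃ Q' : (X.baseChange L).toAffine.Point, (∀ σ : L ≃ₐ[F] L, σ • Q' = Q') ∧
          Q - Q' ∈ (X.baseChange L).goodReductionSubgroup R :=
  hα_of_cyclicH1 X L R φ hφ hn (cyclicH1_of_inflation X L L' R R' φ φ' hcompat hnN hdesc h1')

end Summit.BirchSwinnertonDyer.Rank1Residual.X11b.Three.JetchevKummer

end
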